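import Literature.NumberTheory.EllipticCurves.HeegnerPointsKolyvaginPrimaryRamifiedProofs

/-!
# Route `GenusKolyvaginAtTwo`, crux #3 `KolyvaginExactAtTwo` (stmt-BirchSwinnertonDyer-22137):
# Gross Prop. 6.2 (2) / McCallum Prop. 4.4 AT `p = 2` — the PARITY local criterion in situ
# (helper, PROVED; seat `bsd-line-gk2-p2`, gen 4; memo ANALYSIS-22137 v5.3 §2, leaf A₂)

The tree's `zsmul_kolyvaginClass_mem_selmerLocalKer_iff_mem_torsionLocalKer`
(`HeegnerPointsKolyvaginPrimaryRamifiedProofs`, McCallum Prop. 4.4 in order form) proves, for an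
ODD prime `p`: «`k c_M(mℓ)` is Selmer at `λ` iff `k c_M(m)_λ = 0`», reducing both sides to the
arithmetic of `Ẽ(𝔽_λ)` — left side `χ(k P̃_m) = 0` for McCallum's `χ(c) = a' c − l' φ(c)`
(`a_ℓ = p^M a'`, `ℓ + 1 = p^M l'`, `φ = Frob(ℓ)`), right side `k P̃_m ∈ p^M Ẽ(𝔽_λ)` — and then uses
`ker χ = p^M Ẽ(𝔽_λ)`, whose proof needs the `±`-eigenspaces of `φ` to be cyclic ("since `p` is
odd"). At `p = 2`, `M = 1` there are no eigenspaces, but (memo §2) if `a' = a_ℓ/2` and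
`l' = (ℓ+1)/2` have OPPOSITE parity then `χ ≡ φ` or `χ ≡ 1 (mod 2·End)`, so `χ(b) = 0 ⟹ b ∈ 2Ẽ(𝔽_λ)`
(`GenusExact.exists_two_smul_of_sub_eq_zero`, landed separately; re-proved here in the needed
form to keep this file route-independent). This file proves the resulting ONE-DIRECTIONAL
criterion with the same abstract reduction datum as the tree theorem (hypotheses copied verbatim,
minus `p ≠ 2` and the cyclicity `hcyc`, plus the parity hypothesis):

  `kolyvaginClass_mem_torsionLocalKer_of_mem_selmerLocalKer_two`:
  if `c(P_{mℓ})` is Selmer at `λ` then `c(P_m)_λ = 0`; contrapositively, **`c(P_m)_λ ≠ 0` (for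
  `m = 1`: `ỹ_K ∉ 2Ẽ(𝔽_λ)`) forces `d(mℓ)_λ ≠ 0`** — the local half of leaf A₂ of the `p = 2` base
  case (`LeavesAtTwo.lean`, evidence on the item). No `FrobEqFrobInfty` is involved: the datum only
  needs `F = Frob_λ` to fix `E[2]` and `P_m`, true at every Zhang-form prime (`Frob_ℓ² ≡ 1` on `E[2]`).
BSD is not proved by any of this.
-/

set_option linter.dupNamespace false

noncomputable section

open scoped Classical
open WeierstrassCurve NumberField IsDedekindDomain Field Finset
open Literature.NumberTheory.GaloisRepresentations Literature.NumberTheory.EllipticCurves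
open Literature.NumberTheory.EllipticCurves.KolyvaginCocycle

universe u

namespace Summit.BirchSwinnertonDyer.BirchSwinnertonDyer.Theorems.GenusExact

/-- **The parity replacement for `ker χ ⊆ p^M C` at `p = 2`.** `φ` an additive involution of `C`,
`a', l' ∈ ℤ` of opposite parity: `a' b − l' φ b = 0 ⟹ b ∈ 2C`. (If `l'` is odd and `a'` even,
`φ b = 2(…)` and `b = φ(φ b)`; if `l'` is even and `a'` odd, `b = 2(…)` directly.) [folklore] -/
theorem exists_two_zsmul_of_chi_eq_zero {C : Type*} [AddCommGroup C] (φ : C →+ C)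
    (hφ : ∀ c, φ (φ c) = c) {a' l' : ℤ} (hpar : (Odd l' ∧ Even a') ∨ (Even l' ∧ Odd a'))
    {b : C} (h : a' • b - l' • φ b = 0) : ∃ y : C, (2 : ℤ) • y = b := by
  rw [sub_eq_zero] at h
  rcases hpar with ⟨⟨i, hi⟩, ⟨j, hj⟩⟩ | ⟨⟨i, hi⟩, ⟨j, hj⟩⟩
  · -- `l' = 2i + 1`, `a' = j + j`: `φ b = 2 (j b - i φ b)`, so `b = φ (φ b) = 2 φ(j b - i φ b)`
    rw [hi, hj] at h
    refine ⟨φ (j • b - i • φ b), ?_⟩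
    have h1 : φ b = (2 : ℤ) • (j • b - i • φ b) := by
      calc φ b = (2 * i + 1) • φ b - (2 * i) • φ b := by module
        _ = (j + j) • b - (2 * i) • φ b := by rw [h]
        _ = (2 : ℤ) • (j • b - i • φ b) := by module
    rw [← map_zsmul, ← h1, hφ]
  · -- `l' = i + i`, `a' = 2j + 1`: `b = 2 (i φ b - j b)`
    rw [hi, hj] at h
    refine ⟨i • φ b - j • b, ?_⟩
    calc (2 : ℤ) • (i • φ b - j • b) = (i + i) • φ b - (2 * j) • b := by module
      _ = (2 * j + 1) • b - (2 * j) • b := by rw [h]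
      _ = b := by module

variable {K : Type u} [Field K] [NumberField K] (W : WeierstrassCurve K) [W.IsElliptic]

set_option maxHeartbeats 800000 in
/-- **Gross Prop. 6.2 (2) / McCallum Prop. 4.4 at `p = 2`, `M = 1`, one direction, parity type.**
Same setting and abstract reduction datum as the tree's
`zsmul_kolyvaginClass_mem_selmerLocalKer_iff_mem_torsionLocalKer` with `n = 2`: `P₁ = P_{mℓ}`,
`P₂ = P_m`, `v = λ` good with `2 ∉ λ`, `F` a Frobenius at the prime `𝔓 ∣ λ` cut out by the
completion, fixing `E[2]` and `P₂`; `red : E(K̄) → B` the reduction, `I_𝔓`-invariant, injective on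
`E[2]`, `red ∘ F = φ² ∘ red`, `φ² = 1` on `B[2]`; `l' = (ℓ+1)/2`, `a' = a_ℓ/2` **of opposite
parity** (exactly one of `4 ∣ ℓ+1`, `4 ∣ a_ℓ`; the characteristic relation `(ℓ+1) b = a_ℓ φ b`
of the odd-`p` theorem is not even needed in this direction); the Euler-system root `R₀ = (σ_ℓ − 1)P₁/2` with `red R₀ = l' φ(red P₂) − a' red P₂`;
`c(P₂)` Selmer at `λ`. Conclusion: if `c(P₁)` is Selmer at `λ` then `c(P₂)_λ = 0` in `H¹(K_λ, E[2])`.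
[cite: GrossLMS1991, Prop. 6.2 (2)] [cite: McCallumLMS1991, Prop. 4.4] -/
theorem kolyvaginClass_mem_torsionLocalKer_of_mem_selmerLocalKer_two
    {hdiv : ∀ P : geomPoints W, ∃ Q : geomPoints W, ((2 : ℕ) : ℤ) • Q = P}
    {A₁ A₂ : AddSubgroup (geomPoints W)}
    (hA₁ : IsAdmissible (absoluteGaloisGroup K) A₁ ((2 : ℕ) : ℤ))
    (hA₂ : IsAdmissible (absoluteGaloisGroup K) A₂ ((2 : ℕ) : ℤ))
    {P₁ P₂ : geomPoints W}
    (hP₁ : P₁ ∈ invPoints (absoluteGaloisGroup K) A₁ ((2 : ℕ) : ℤ))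
    (hP₂ : P₂ ∈ invPoints (absoluteGaloisGroup K) A₂ ((2 : ℕ) : ℤ))
    -- the place `λ`
    {v : HeightOneSpectrum (𝓞 K)} (hgood : W.HasGoodReductionAt v) (hpv : ((2 : ℕ) : 𝓞 K) ∉ v.asIdeal)
    {𝔐 : Ideal (HeightOneSpectrum.localAbsIntegers v)} (h𝔐 : 𝔐 ∈ v.localPrimesAbove)
    {F : absoluteGaloisGroup K}
    (hF : IsArithFrobAt (𝓞 K) F (v.primeBelow (closureEmb (K := K) (v.adicCompletion K)) 𝔐))
    (hFfix : F ∈ torsionFixing W ((2 : ℕ) : ℤ))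
    (hsurj : Function.Surjective (torsionPointsMap W (v.adicCompletion K) ((2 : ℕ) : ℤ)))
    -- the reduction datum at `𝔓`
    {B : Type*} [AddCommGroup B] (red : geomPoints W →+ B) (φ : B →+ B)
    (hredI : ∀ τ ∈ (v.primeBelow (closureEmb (K := K) (v.adicCompletion K)) 𝔐).inertia
      (absoluteGaloisGroup K), ∀ x : geomPoints W, red (τ • x) = red x)
    (hredF : ∀ x : geomPoints W, red (F • x) = φ (φ (red x)))
    (hred : ∀ x : geomPoints W, ((2 : ℕ) : ℤ) • x = 0 → red x = 0 → x = 0)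
    (hBn : ∀ b : B, ((2 : ℕ) : ℤ) • b = 0 → φ (φ b) = b)
    -- the arithmetic of `Ẽ(F_λ) = {φ² = 1}` at a parity-type prime
    {l' a' : ℤ} (hpar : (Odd l' ∧ Even a') ∨ (Even l' ∧ Odd a'))
    -- the Euler-system data at `λ`
    {τ₀ : absoluteGaloisGroup K}
    (hτ₀ : τ₀ ∈ (v.primeBelow (closureEmb (K := K) (v.adicCompletion K)) 𝔐).inertia
      (absoluteGaloisGroup K))
    {R₀ : geomPoints W} (hR₀A : R₀ ∈ A₁) (hR₀ : ((2 : ℕ) : ℤ) • R₀ = τ₀ • P₁ - P₁)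
    (hR₀red : red R₀ = l' • φ (red P₂) - a' • red P₂)
    (hFP₂ : F • P₂ = P₂)
    (hsel₂ : kolyvaginClass W _ hdiv hA₂ P₂ hP₂ ∈ selmerLocalKer W (v.adicCompletion K) ((2 : ℕ) : ℤ))
    (hsel₁ : kolyvaginClass W _ hdiv hA₁ P₁ hP₁ ∈ selmerLocalKer W (v.adicCompletion K) ((2 : ℕ) : ℤ)) :
    kolyvaginClass W _ hdiv hA₂ P₂ hP₂ ∈ W.torsionLocalKer (v.adicCompletion K) ((2 : ℕ) : ℤ) := by
  set 𝔓 := v.primeBelow (closureEmb (K := K) (v.adicCompletion K)) 𝔐 with h𝔓def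
  have h𝔓 : 𝔓 ∈ v.primesAbove := HeightOneSpectrum.primeBelow_mem_primesAbove h𝔐
  have hn0 : ((2 : ℕ) : ℤ) ≠ 0 := by norm_num
  have hnv : ((((2 : ℕ) : ℤ)) : 𝓞 K) ∉ v.asIdeal := by
    rw [Int.cast_natCast]; exact hpv
  -- ### left side: `red R₀ = 0` from the Selmer condition of `c(P₁)` at `λ`, tested on `τ₀`
  have hL : red R₀ = 0 := by
    have h := (zsmul_kolyvaginClass_mem_selmerLocalKer_iff_of_red W hA₁ hP₁ hgood hnv h𝔓 red
      hredI hred 1).mp (by rw [one_zsmul]; exact hsel₁)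
    have hroot : rootIn A₁ ((2 : ℕ) : ℤ) (τ₀ • P₁ - P₁) = R₀ :=
      rootIn_eq hA₁.eq_zero_of_zsmul hR₀A hR₀
    have h0 := h τ₀ hτ₀
    rwa [hroot, one_zsmul] at h0
  -- ### `χ(P̃₂) = 0` on `B₀ = {φ² = 1}`, hence `P̃₂ ∈ 2 B₀` by the parity lemma
  have hP₂fix : φ (φ (red P₂)) = red P₂ := by rw [← hredF, hFP₂]
  have hchi : a' • red P₂ - l' • φ (red P₂) = 0 := by
    rw [← neg_sub, ← hR₀red, hL, neg_zero]
  -- work in the subgroup `B₀ = {φ² = 1}` on which `φ` is an involution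
  set φ2 : B →+ B := φ.comp φ with hφ2def
  set B₀ : AddSubgroup B := φ2.eqLocus (AddMonoidHom.id B) with hB₀def
  have hmemB₀ : ∀ {b : B}, b ∈ B₀ ↔ φ (φ b) = b := fun {b} ↦ Iff.rfl
  have hφB₀ : ∀ b ∈ B₀, φ b ∈ B₀ := fun b hb ↦ by
    rw [hmemB₀] at hb ⊢
    rw [hb]
  set φ₀ : B₀ →+ B₀ := (φ.comp B₀.subtype).codRestrict B₀ (fun b ↦ hφB₀ b b.2) with hφ₀def
  have hφ₀ : ∀ b : B₀, (φ₀ b : B) = φ b := fun b ↦ rfl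
  have hφ₀inv : ∀ b : B₀, φ₀ (φ₀ b) = b := fun b ↦ Subtype.ext (by rw [hφ₀, hφ₀]; exact b.2)
  have hP₂B₀ : red P₂ ∈ B₀ := hmemB₀.mpr hP₂fix
  have hchi₀ : a' • (⟨red P₂, hP₂B₀⟩ : B₀) - l' • φ₀ ⟨red P₂, hP₂B₀⟩ = 0 := by
    apply Subtype.ext
    rw [AddSubgroupClass.coe_sub, AddSubgroupClass.coe_zsmul, AddSubgroupClass.coe_zsmul, hφ₀,
      AddSubgroup.coe_zero]
    exact hchi
  obtain ⟨y, hy⟩ := exists_two_zsmul_of_chi_eq_zero φ₀ hφ₀inv hpar hchi₀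
  -- ### right side: `c(P₂)_λ = 0` iff `P̃₂ ∈ 2 Ẽ(F_λ)^{φ²}`
  rw [← one_zsmul (kolyvaginClass W _ hdiv hA₂ P₂ hP₂),
    zsmul_kolyvaginClass_mem_torsionLocalKer_iff_of_red W hA₂ hP₂ hgood hnv hn0 h𝔐 hF hFfix hsurj
      hsel₂ hFP₂ red φ2 (fun x ↦ hredF x) hred (fun b hb ↦ hBn b hb) 1]
  refine ⟨y, y.2, ?_⟩
  have h := congrArg Subtype.val hy
  rw [AddSubgroupClass.coe_zsmul] at h
  rw [one_zsmul]
  change red P₂ = ((2 : ℕ) : ℤ) • (y : B)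
  rw [Nat.cast_ofNat]
  exact h.symm

end Summit.BirchSwinnertonDyer.BirchSwinnertonDyer.Theorems.GenusExact

end
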